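import Summits.Ventures.Crystal3D.Theorems.StickyWulffConstantNoReconstructionGainLatticeAdhesion
import HarnessLib

/-!
# The two-grain ledger: inclusion–exclusion for the contact deficiency

HONEST FRAMING. Part of the venture `Summits/Ventures/Crystal3D` (cell `crystal3d-full`), helper
`--supports` the crux `CoaxialWallLaw` (stmt-Ventures-19481, `route-Ventures-StickyWulffConstant`),
REGISTERED line `WallLedgerF` (planner cf-p1 gen 16; memo HOME/cf-p1/ROUTE.md §68), and equally
usable by line `WallLedgerG` of `GenericWallFloor` (stmt-Ventures-19480).  Pure finite
combinatorics of the deficiency `D(X) = 6·#X − ½·orderedContacts X`; no lattice enters.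

THE RIGID-BICRYSTAL LEDGER.  The first rung of both wall lines is the RIGID filling
`X ⊆ Λ₁ ∪ Λ₂` (every ball on one of the two grains).  Writing `X₁ = X ∩ Λ₁`, `X₂ = X ∩ Λ₂`,
inclusion–exclusion on `#` and on the set of contact PAIRS gives the exact identity

  `D(X₁ ∪ X₂) + D(X₁ ∩ X₂) + #cross(X₁ \ X₂, X₂ \ X₁) = D(X₁) + D(X₂)`

(`contactDeficiency_union_add_inter`): the deficiency of the bicrystal is the sum of the two
grains' own deficiencies (each bounded below by its bond-line/run count, as in
`Theorems.stub_sampleDeficit`), minus the deficiency of the COINCIDENCE balls `X₁ ∩ X₂` (each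
absorbs at most `6`), minus the MIXED contacts between a pure-`Λ₁` ball and a pure-`Λ₂` ball (each
absorbs `1`).  For a co-axial pair the in-plane bond classes are shared by both grains, so the
in-plane runs of `X₁` and of `X₂` are runs of `X` and a riser (where in-plane lines break) is paid
unless absorbed by coincidence balls or mixed contacts — the terrace/riser reading of the stub
`stub_coaxialTwoSlabAdhesion`.  Also recorded: the cross count splits over a disjoint union of the
first factor (`card_crossContacts_union_left`) and the filter form of the identity for
`X ⊆ Λ₁ ∪ Λ₂` (`contactDeficiency_two_grains`).

WHAT THIS IS NOT: no lower bound is proved here (the run counts and the absorption bounds are the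
line's remaining work); the stub and the crux are untouched; rung F-C1 not moved.
-/

noncomputable section

namespace Summit.Ventures.Crystal3D.Theorems

open Summit.Ventures.Crystal3D Finset
open Literature.MathematicalPhysics.StatisticalMechanics (orderedContacts contactDeficiency)

/-- The cross-contact count is additive over a disjoint union in the first factor. -/
theorem card_crossContacts_union_left (P P' Q : Finset (EuclideanSpace ℝ (Fin 3)))
    (h : Disjoint P P') :
    ((((P ∪ P') ×ˢ Q).filter fun pq => dist pq.1 pq.2 = 1).card : ℕ) =
      ((P ×ˢ Q).filter fun pq => dist pq.1 pq.2 = 1).card +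
        ((P' ×ˢ Q).filter fun pq => dist pq.1 pq.2 = 1).card := by
  classical
  rw [Finset.union_product, Finset.filter_union, Finset.card_union_of_disjoint]
  exact Finset.disjoint_filter_filter (Finset.disjoint_product.2 (Or.inl h))

/-- The cross-contact count is additive over a disjoint union in the second factor. -/
theorem card_crossContacts_union_right (P Q Q' : Finset (EuclideanSpace ℝ (Fin 3)))
    (h : Disjoint Q Q') :
    (((P ×ˢ (Q ∪ Q')).filter fun pq => dist pq.1 pq.2 = 1).card : ℕ) =
      ((P ×ˢ Q).filter fun pq => dist pq.1 pq.2 = 1).card +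
        ((P ×ˢ Q').filter fun pq => dist pq.1 pq.2 = 1).card := by
  classical
  rw [Finset.product_union, Finset.filter_union, Finset.card_union_of_disjoint]
  exact Finset.disjoint_filter_filter (Finset.disjoint_product.2 (Or.inr h))

/-- The cross-contact count is symmetric. -/
theorem card_crossContacts_comm (P Q : Finset (EuclideanSpace ℝ (Fin 3))) :
    (((P ×ˢ Q).filter fun pq => dist pq.1 pq.2 = 1).card : ℕ) =
      ((Q ×ˢ P).filter fun pq => dist pq.1 pq.2 = 1).card := by
  classical
  have h₁ := card_crossContacts_eq_sum_sum P Q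
  have h₂ := card_crossContacts_eq_sum_sum Q P
  have hswap : ∑ p ∈ P, ∑ q ∈ Q, (if dist p q = 1 then (1 : ℝ) else 0) =
      ∑ q ∈ Q, ∑ p ∈ P, (if dist q p = 1 then (1 : ℝ) else 0) := by
    rw [Finset.sum_comm]
    refine Finset.sum_congr rfl fun q _ => Finset.sum_congr rfl fun p _ => ?_
    rw [dist_comm]
  rw [hswap, ← h₂] at h₁
  exact_mod_cast h₁

/-- **Inclusion–exclusion for the contact deficiency (the two-grain ledger).**  For any two finite
sets of points `A, B ⊂ ℝ³`:
`D(A ∪ B) + D(A ∩ B) + #{(p, q) ∈ (A \ B) × (B \ A) : dist p q = 1} = D(A) + D(B)`. -/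
theorem contactDeficiency_union_add_inter (A B : Finset (EuclideanSpace ℝ (Fin 3))) :
    contactDeficiency (A ∪ B) + contactDeficiency (A ∩ B) +
        (((((A \ B) ×ˢ (B \ A)).filter fun pq => dist pq.1 pq.2 = 1).card : ℕ) : ℝ) =
      contactDeficiency A + contactDeficiency B := by
  classical
  -- split `A ∪ B` over `A`, and `B` over `A ∩ B`
  have h₁ := contactDeficiency_sdiff_split (Finset.subset_union_left : A ⊆ A ∪ B)
  have h₂ := contactDeficiency_sdiff_split (Finset.inter_subset_right : A ∩ B ⊆ B)
  have e₁ : (A ∪ B) \ A = B \ A := by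
    ext p; simp only [mem_sdiff, mem_union]; tauto
  have e₂ : B \ (A ∩ B) = B \ A := by
    ext p; simp only [mem_sdiff, mem_inter]; tauto
  rw [e₁] at h₁
  rw [e₂] at h₂
  -- `cross(A, B \ A) = cross(A \ B, B \ A) + cross(A ∩ B, B \ A)`
  have hA : A = (A \ B) ∪ (A ∩ B) := by
    ext p; simp only [mem_union, mem_sdiff, mem_inter]; tauto
  have hdisj : Disjoint (A \ B) (A ∩ B) := by
    rw [Finset.disjoint_left]
    intro p hp hq
    exact (mem_sdiff.1 hp).2 (mem_inter.1 hq).2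
  have hsplit : ((((A ×ˢ (B \ A)).filter fun pq => dist pq.1 pq.2 = 1).card : ℕ) : ℝ) =
      (((((A \ B) ×ˢ (B \ A)).filter fun pq => dist pq.1 pq.2 = 1).card : ℕ) : ℝ) +
        (((((A ∩ B) ×ˢ (B \ A)).filter fun pq => dist pq.1 pq.2 = 1).card : ℕ) : ℝ) := by
    have hc := card_crossContacts_union_left (A \ B) (A ∩ B) (B \ A) hdisj
    rw [← hA] at hc
    exact_mod_cast hc
  rw [hsplit] at h₁
  linarith

/-- **The rigid-bicrystal form.**  If every ball of `X` lies on `Λ₁` or on `Λ₂` (two arbitrary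
point sets of `ℝ³`), then with `X₁ = X ∩ Λ₁`, `X₂ = X ∩ Λ₂` (as filters):
`D(X) = D(X₁) + D(X₂) − D(X₁ ∩ X₂) − #cross(X₁ \ X₂, X₂ \ X₁)`. -/
theorem contactDeficiency_two_grains (Λ₁ Λ₂ : Set (EuclideanSpace ℝ (Fin 3)))
    [DecidablePred (· ∈ Λ₁)] [DecidablePred (· ∈ Λ₂)]
    (X : Finset (EuclideanSpace ℝ (Fin 3))) (hX : ∀ p ∈ X, p ∈ Λ₁ ∨ p ∈ Λ₂) :
    contactDeficiency X =
      contactDeficiency (X.filter (· ∈ Λ₁)) + contactDeficiency (X.filter (· ∈ Λ₂)) -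
        contactDeficiency (X.filter (· ∈ Λ₁) ∩ X.filter (· ∈ Λ₂)) -
        (((((X.filter (· ∈ Λ₁) \ X.filter (· ∈ Λ₂)) ×ˢ (X.filter (· ∈ Λ₂) \ X.filter (· ∈ Λ₁))).filter
          fun pq => dist pq.1 pq.2 = 1).card : ℕ) : ℝ) := by
  classical
  have hU : X.filter (· ∈ Λ₁) ∪ X.filter (· ∈ Λ₂) = X := by
    ext p
    simp only [mem_union, mem_filter]
    constructor
    · rintro (⟨hp, -⟩ | ⟨hp, -⟩) <;> exact hp
    · intro hp
      rcases hX p hp with h | h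
      · exact Or.inl ⟨hp, h⟩
      · exact Or.inr ⟨hp, h⟩
  have h := contactDeficiency_union_add_inter (X.filter (· ∈ Λ₁)) (X.filter (· ∈ Λ₂))
  rw [hU] at h
  linarith

end Summit.Ventures.Crystal3D.Theorems

end
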